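import Mathlib.Geometry.Manifold.SmoothEmbedding
import Literature.Geometry.Lorentzian.Causality
import Literature.Geometry.Lorentzian.Hypersurface
import HarnessLib

/-!
# Cauchy temporal functions with two prescribed levels; spacelike Cauchy hypersurfaces with prescribed exterior

Two named facts (D-0014) from P. Bernard, S. Suhr, *Cauchy and uniform temporal functions of globally
hyperbolic cone fields*, Proc. Amer. Math. Soc. 148 (2020) 4951–4966 (arXiv:1905.06006), Prop. 3.4 and
Prop. 3.5, SPECIALISED from closed cone fields to smooth spacetimes (`Spacetime`: connected, Hausdorff,
second countable, smooth time-oriented Lorentzian `(n+1)`-manifold) and WEAKENED: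

* `bernardSuhr2020_twoLevelCauchyTemporal` — Prop. 3.4 (arXiv p. 9): "Let `H₀, H₁` be two spatial subsets
  such that `H₁ ∩ J⁻(H₀) = ∅`, and let `g` be a complete Riemannian metric on `M`. Then there exists a Cauchy
  temporal function `τ` such that `τ = i` on `H_i` for `i = 0, 1`, and which is `g`-uniform in `{τ ≥ 9/10}`
  and in `{τ ≤ 1/10}`."
* `bernardSuhr2020_spatialExtensionEqualAtInfinity` — Prop. 3.5, second part (arXiv p. 9): "Let `𝒞` be a
  globally hyperbolic cone field without degenerate points, and let `Σ` be a spacelike hypersurface. Then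
  each compact subset `K ⊂ Σ` is contained in a spatial hypersurface `H`. Moreover, if `N⁻, N⁺` are two
  spatial sets such that `Σ ⊂ J⁺(N⁻) ∩ J⁻(N⁺)`, the spatial hypersurface `H` containing `K` can be chosen
  inside `J⁺(N⁻) ∩ J⁻(N⁺)` and equal to `N⁻` at infinity" — "at infinity (meaning, outside of a compact set
  of `M`)" (arXiv p. 10); in the proof `H` is the graph of a compactly supported smooth `f : N⁻ → [0, 1]` in
  the identification `M = N⁻ × ℝ` (arXiv p. 10).

Dictionary (loc. cit., arXiv p. 3–4): the cone field of a smooth time-oriented Lorentzian metric is a closed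
cone field without degenerate points, hence locally solvable; a causal function `τ` "is said Cauchy if
`τ ∘ γ : I → ℝ` is onto for each inextensible causal curve `γ`" (p. 3), so EVERY real level of a Cauchy
temporal function is met exactly once by every inextendible causal curve; "temporal" = smooth with
`dτ_x · v > 0` for every `(x, v)` in the cone; "spatial" = "spacelike, intersects each inextensible causal
curve at one and only one point" (p. 4).  For a smooth SPACELIKE hypersurface of a spacetime, being met
exactly once by every inextendible causal curve is the same as being a Cauchy hypersurface in O'Neill's
sense (`LorentzianMetric.IsCauchyHypersurface`: met exactly once by every endless timelike curve): a
Cauchy hypersurface is met by every inextendible causal curve (O'Neill 1983, Ch. 14, Lemma 14.29) and an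
achronal spacelike hypersurface is acausal (loc. cit., Lemma 14.42); this is how "spatial" is rendered.

WEAKENINGS.  Prop. 3.4: the `g`-uniformity clauses are dropped; "Cauchy temporal" is rendered as `C^∞` +
`dτ(v) > 0` for every future-directed vector `v` of the time orientation + every level a Cauchy
hypersurface; both spatial sets are presented as ranges of smooth spacelike embeddings of `n`-manifolds
with Cauchy range.  Prop. 3.5 (second part only): `Σ` is presented as the range of a smooth spacelike
embedding `κ : Y → M` of an `n`-manifold, `N⁻ = range ι`, `N⁺ = range ιu` for smooth spacelike embeddings
with Cauchy ranges; "equal to `N⁻` at infinity" + the graph description are rendered by a parametrisation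
`ι' : X → M` of `H` over the SAME `X` as `N⁻` which agrees with `ι` off a compact `K ⊆ X`; the
`[0, 1]`-valuedness of `f` is dropped.

Provenance: decomp-fsc lens-4 g39 side file `PrescribedExteriorByTree39.lean` (statements verbatim,
re-homed into `namespace Literature.Geometry.Lorentzian`).  NOT here: the first part of Prop. 3.5, the
uniformity theory (Thm. 1, Thm. 2 of loc. cit.), anything about cone fields beyond spacetimes.
-/

noncomputable section

open Set Function
open scoped Manifold ContDiff Topology

namespace Literature.Geometry.Lorentzian

/-- **Bernard–Suhr 2020, Prop. 3.4 (two prescribed levels), weakened.** In a spacetime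
`𝓜 = (M, g, τ_g)` of dimension `n + 1` let `ι₀ : X₀ → M`, `ι₁ : X₁ → M` be smooth spacelike
embeddings of `n`-manifolds whose ranges `H₀ = ι₀(X₀)`, `H₁ = ι₁(X₁)` are Cauchy hypersurfaces with
`H₁ ∩ J⁻(H₀) = ∅`. Then there is a `C^∞` function `τ : M → ℝ` with `dτ(v) > 0` for every
future-directed causal vector `v`, all of whose levels `τ⁻¹(c)` are Cauchy hypersurfaces, with
`τ = 0` on `H₀` and `τ = 1` on `H₁`. Specialised to spacetimes via the dictionary of the module
docstring (O'Neill 1983, Ch. 14, Lemmas 14.29, 14.42); uniformity clauses dropped.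
[cite: BernardSuhr2020, Prop. 3.4 (arXiv:1905.06006 p. 9)] -/
def bernardSuhr2020_twoLevelCauchyTemporal : Prop :=
  ∀ {n : ℕ} (𝓜 : Spacetime.{0} (n + 1)) (X₀ X₁ : Type) [TopologicalSpace X₀]
    [ChartedSpace (EuclideanSpace ℝ (Fin n)) X₀] [IsManifold (𝓡 n) ∞ X₀] [TopologicalSpace X₁]
    [ChartedSpace (EuclideanSpace ℝ (Fin n)) X₁] [IsManifold (𝓡 n) ∞ X₁]
    (ι₀ : X₀ → 𝓜.carrier) (ι₁ : X₁ → 𝓜.carrier),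
    Manifold.IsSmoothEmbedding (𝓡 n) (𝓡 (n + 1)) ∞ ι₀ →
    𝓜.metric.toPseudoRiemannianMetric.IsSpacelikeImmersion (𝓡 n) ι₀ →
    𝓜.metric.IsCauchyHypersurface 𝓜.timeOrientation (range ι₀) →
    Manifold.IsSmoothEmbedding (𝓡 n) (𝓡 (n + 1)) ∞ ι₁ →
    𝓜.metric.toPseudoRiemannianMetric.IsSpacelikeImmersion (𝓡 n) ι₁ →
    𝓜.metric.IsCauchyHypersurface 𝓜.timeOrientation (range ι₁) →
    range ι₁ ∩ 𝓜.metric.causalPast 𝓜.timeOrientation (range ι₀) = ∅ →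
    ∃ τ : 𝓜.carrier → ℝ,
      ContMDiff (𝓡 (n + 1)) 𝓘(ℝ, ℝ) ∞ τ ∧
      (∀ (p : 𝓜.carrier) (v : TangentSpace (𝓡 (n + 1)) p),
        𝓜.timeOrientation.IsFutureDirected v →
          (0 : ℝ) < mfderiv (𝓡 (n + 1)) 𝓘(ℝ, ℝ) τ p v) ∧
      (∀ c : ℝ, 𝓜.metric.IsCauchyHypersurface 𝓜.timeOrientation (τ ⁻¹' {c})) ∧
      (∀ x : X₀, τ (ι₀ x) = 0) ∧ (∀ x : X₁, τ (ι₁ x) = 1)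

/-- **Bernard–Suhr 2020, Prop. 3.5, second part (spacelike Cauchy extension with prescribed
exterior), weakened.** In a spacetime `𝓜 = (M, g, τ_g)` of dimension `n + 1` let `ι, ιu : X → M`,
resp. `Xu → M`, be smooth spacelike embeddings of `n`-manifolds with Cauchy ranges `N⁻ = ι(X)`,
`N⁺ = ιu(Xu)`, let `κ : Y → M` be a smooth spacelike embedding of an `n`-manifold (the spacelike
hypersurface `Σ`) with `κ(Y) ⊆ J⁺(N⁻) ∩ J⁻(N⁺)`, and let `A ⊆ κ(Y)` be compact. Then there is a
smooth spacelike embedding `ι' : X → M` whose range is a Cauchy hypersurface containing `A` and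
contained in `J⁺(N⁻) ∩ J⁻(N⁺)`, and a compact `K ⊆ X` with `ι' x = ι x` for every `x ∉ K`
("equal to `N⁻` at infinity": `H` is the graph of a compactly supported smooth `f` over `N⁻`).
Specialised to spacetimes via the dictionary of the module docstring; second part of the
Proposition only. [cite: BernardSuhr2020, Prop. 3.5 (arXiv:1905.06006 pp. 9–10)] -/
def bernardSuhr2020_spatialExtensionEqualAtInfinity : Prop :=
  ∀ {n : ℕ} (𝓜 : Spacetime.{0} (n + 1)) (X Xu Y : Type) [TopologicalSpace X]
    [ChartedSpace (EuclideanSpace ℝ (Fin n)) X] [IsManifold (𝓡 n) ∞ X] [TopologicalSpace Xu]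
    [ChartedSpace (EuclideanSpace ℝ (Fin n)) Xu] [IsManifold (𝓡 n) ∞ Xu] [TopologicalSpace Y]
    [ChartedSpace (EuclideanSpace ℝ (Fin n)) Y] [IsManifold (𝓡 n) ∞ Y]
    (ι : X → 𝓜.carrier) (ιu : Xu → 𝓜.carrier) (κ : Y → 𝓜.carrier) (A : Set 𝓜.carrier),
    Manifold.IsSmoothEmbedding (𝓡 n) (𝓡 (n + 1)) ∞ ι →
    𝓜.metric.toPseudoRiemannianMetric.IsSpacelikeImmersion (𝓡 n) ι →
    𝓜.metric.IsCauchyHypersurface 𝓜.timeOrientation (range ι) →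
    Manifold.IsSmoothEmbedding (𝓡 n) (𝓡 (n + 1)) ∞ ιu →
    𝓜.metric.toPseudoRiemannianMetric.IsSpacelikeImmersion (𝓡 n) ιu →
    𝓜.metric.IsCauchyHypersurface 𝓜.timeOrientation (range ιu) →
    Manifold.IsSmoothEmbedding (𝓡 n) (𝓡 (n + 1)) ∞ κ →
    𝓜.metric.toPseudoRiemannianMetric.IsSpacelikeImmersion (𝓡 n) κ →
    range κ ⊆ 𝓜.metric.causalFuture 𝓜.timeOrientation (range ι) ∩
      𝓜.metric.causalPast 𝓜.timeOrientation (range ιu) →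
    IsCompact A → A ⊆ range κ →
    ∃ (ι' : X → 𝓜.carrier) (K : Set X),
      Manifold.IsSmoothEmbedding (𝓡 n) (𝓡 (n + 1)) ∞ ι' ∧
      𝓜.metric.toPseudoRiemannianMetric.IsSpacelikeImmersion (𝓡 n) ι' ∧
      𝓜.metric.IsCauchyHypersurface 𝓜.timeOrientation (range ι') ∧
      A ⊆ range ι' ∧
      range ι' ⊆ 𝓜.metric.causalFuture 𝓜.timeOrientation (range ι) ∩
        𝓜.metric.causalPast 𝓜.timeOrientation (range ιu) ∧
      IsCompact K ∧ ∀ x, x ∉ K → ι' x = ι x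

/-- Corollary shape of the Prop. 3.5 fact (forgetting the embedding / spacelike / sandwich clauses of
the conclusion): under `bernardSuhr2020_spatialExtensionEqualAtInfinity`, a compact piece `A` of a spacelike
hypersurface sandwiched between two spacelike Cauchy hypersurfaces `ι(X)`, `ιu(Xu)` lies in a
spacelike Cauchy hypersurface `ι'(X)` which agrees with `ι` off a compact subset of `X`.
[cite: BernardSuhr2020, Prop. 3.5 (arXiv:1905.06006 pp. 9–10)] -/
theorem exists_cauchy_through_agreeing_off_compact
    (h : bernardSuhr2020_spatialExtensionEqualAtInfinity) {n : ℕ} (𝓜 : Spacetime.{0} (n + 1))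
    (X Xu Y : Type) [TopologicalSpace X] [ChartedSpace (EuclideanSpace ℝ (Fin n)) X]
    [IsManifold (𝓡 n) ∞ X] [TopologicalSpace Xu] [ChartedSpace (EuclideanSpace ℝ (Fin n)) Xu]
    [IsManifold (𝓡 n) ∞ Xu] [TopologicalSpace Y] [ChartedSpace (EuclideanSpace ℝ (Fin n)) Y]
    [IsManifold (𝓡 n) ∞ Y] (ι : X → 𝓜.carrier) (ιu : Xu → 𝓜.carrier) (κ : Y → 𝓜.carrier)
    (A : Set 𝓜.carrier) (hι : Manifold.IsSmoothEmbedding (𝓡 n) (𝓡 (n + 1)) ∞ ι)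
    (hιs : 𝓜.metric.toPseudoRiemannianMetric.IsSpacelikeImmersion (𝓡 n) ι)
    (hιC : 𝓜.metric.IsCauchyHypersurface 𝓜.timeOrientation (range ι))
    (hιu : Manifold.IsSmoothEmbedding (𝓡 n) (𝓡 (n + 1)) ∞ ιu)
    (hιus : 𝓜.metric.toPseudoRiemannianMetric.IsSpacelikeImmersion (𝓡 n) ιu)
    (hιuC : 𝓜.metric.IsCauchyHypersurface 𝓜.timeOrientation (range ιu))
    (hκ : Manifold.IsSmoothEmbedding (𝓡 n) (𝓡 (n + 1)) ∞ κ)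
    (hκs : 𝓜.metric.toPseudoRiemannianMetric.IsSpacelikeImmersion (𝓡 n) κ)
    (hκJ : range κ ⊆ 𝓜.metric.causalFuture 𝓜.timeOrientation (range ι) ∩
      𝓜.metric.causalPast 𝓜.timeOrientation (range ιu))
    (hA : IsCompact A) (hAκ : A ⊆ range κ) :
    ∃ (ι' : X → 𝓜.carrier) (K : Set X),
      𝓜.metric.IsCauchyHypersurface 𝓜.timeOrientation (range ι') ∧ A ⊆ range ι' ∧
      IsCompact K ∧ ∀ x, x ∉ K → ι' x = ι x := by
  obtain ⟨ι', K, -, -, hC, hA', -, hK, heq⟩ :=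
    h 𝓜 X Xu Y ι ιu κ A hι hιs hιC hιu hιus hιuC hκ hκs hκJ hA hAκ
  exact ⟨ι', K, hC, hA', hK, heq⟩

end Literature.Geometry.Lorentzian

end
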